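import Literature.Barriers.CriticalPhenomena.PlaquetteWalkHoleRootKillForcedZeroSchema
import HarnessLib

/-!
# Barrier catalogue (SAWScalingLimit): the SIGN of the Yang–Baxter vertex functional at the honeycomb point and at its
dual from ONE absent corner cell — LAW L's single-removal rows as structural theorems

Leaf of `PlaquetteWalkHoleRootKillForcedZeroSchema`. The venture lane's LAW L (`FINDING-YB-KILL-FORCED-ZEROS.md` §5) is a
statement about SINGLE removals: in a single-hole box, removing alone ONE of the four corner cells two rows away from
the far cell / the root plaquette kills exactly one route at exactly one of the two angles `π/3`, `2π/3` (33/33 observed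
kills on 13 frames). The companion `PlaquetteWalkHoleRootKillForcedZeros` turns «one route killed, the other free» into
a definite SIGN of `Im VF` at that angle (`im_vertexFunctional_printed_farCellW_…_of_{under,over}_killed`), the
universal kill being a hypothesis there and a theorem since the STRUCTURAL KILL files; the free route's witness stayed a
hypothesis. With the witness blocks of the schema leaf the four sign statements become CLOSED SCHEMAS:

* §1 (reference position `w = (4,2)`): ★★★★ `im_pos_pi_div_three_of_killSW_block42` (`K_S2 = (1,0)` absent, west block
  present ⇒ `Im VF(π/3) > 0`), `im_neg_two_pi_div_three_of_killNW_block42` (`K_N1 = (1,4)` ⇒ `Im VF(2π/3) < 0`),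
  `im_neg_pi_div_three_of_killNE_block42` (`K_N2 = (5,4)`, east block ⇒ `Im VF(π/3) < 0`),
  `im_pos_two_pi_div_three_of_killSE_block42` (`K_S1 = (5,0)` ⇒ `Im VF(2π/3) > 0`) — each with the hole absent and the
  (box-vacuous) column condition of its quadrant theorem, and NOTHING about the other three corner cells.
* §2 (every position, by `vertexFunctional_printed_shiftBy`): ★★★★★ `im_vertexFunctional_printed_pi_div_three_pos_of_killSW_block`,
  `…_two_pi_div_three_neg_of_killNW_block`, `…_pi_div_three_neg_of_killNE_block`, `…_two_pi_div_three_pos_of_killSE_block`.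

So each of the four rows of LAW L is, as a SIGN statement, a theorem about every finite face domain containing the
22-cell witness block; two opposite rows together give the kill-forced zero of the schema leaf by continuity. Not in
print; venture lane «pcv-sawmu», seat b-step0 gen 25.

References: A. Glazman, I. Manolescu, arXiv:1708.00395v3, §1 (Fig. 2, the remark after eq. (1)), §4.2 and Lemma 2.1
[GlazmanManolescu2019]; A. Glazman, Electron. Commun. Probab. 20 (2015) no. 86, Lemma 3.1, proof pp. 6–7
[Glazman2015WeightedSAW]; R. Courant, H. Robbins, *What is Mathematics?* (1941/1958), Ch. V Appendix §2 (the even–odd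
rule) [CourantRobbins1958]; H. Duminil-Copin, S. Smirnov, Ann. of Math. 175 (2012), Lemma 1 [DuminilCopinSmirnov2012].
-/

noncomputable section

open Set Function Complex

namespace Literature.Barriers.CriticalPhenomena.PlaquetteWalk

open Literature.Probability.RandomPlanarGeometry.SAW.YangBaxter
open Real Complex

/-! ## §1 The four signs at the reference position -/

section At42

variable {Dl : List Face}

/-- The far cell is rooted once the hole is absent and the far cell present. [cite: GlazmanManolescu2019, §2.1 (walks start on the boundary of the domain)] -/
theorem rootedFace_of_farW_mem_of_hole (hf : farW w42 ∈ Dl) (hh : holeFaceW w42 ∉ dom Dl) :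
    RootedFace (dom Dl) (w42.side .W) (farW w42) :=
  ⟨hf, fun hb => hh (by rw [root_faces_W] at hb; exact hb.1)⟩

/-- ★★★★ **`K_S2` ALONE ⇒ `Im VF(π/3) > 0`**, reference position: west block present, hole and `K_S2 = (1,0)` absent, no
western door of the far cell's column below row `0` (vacuous for boxes) ⇒ the under route is `w₂`-killed (QUADRANT leaf)
and the block's over witness is `w₂`-free, so `Im VF(π/3) = x_c² · M_N(π/3) > 0`.
[cite: GlazmanManolescu2019, Lemma 2.1 (statement, "in the form given in [Gl]")] [cite: GlazmanManolescu2019, §1 (the paragraph of Fig. 2)] -/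
theorem im_pos_pi_div_three_of_killSW_block42 (hB : ∀ c ∈ westBlock42, c ∈ Dl) (hh : holeFaceW w42 ∉ dom Dl)
    (hKS : killSW w42 ∉ dom Dl)
    (hcolS : ∀ y : ℤ, y ≤ w42.2 - 3 → (w42.1 - 3, y) ∉ dom Dl ∨ (w42.1 - 2, y) ∉ dom Dl) :
    0 < (vertexFunctional (printedWeights (π / 3)) tFiveEighths (ybCoeff (π / 3)) Dl (w42.side .W) (farW w42)).im := by
  have hf : farW w42 ∈ Dl := hB _ (by decide)
  have hr := rootedFace_of_farW_mem_of_hole hf hh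
  exact im_vertexFunctional_printed_farCellW_pi_div_three_pos_of_under_killed Dl w42 hf hh hr
    (ΩG.under_killed_of_killSW_quadrant hh hKS (fun y hy => (hcolS y hy).elim Or.inl fun h => Or.inr (Or.inl h)) hr _)
    (exists_over_witness_of_westBlock42 hB hr _)

/-- ★★★★ **`K_N1` ALONE ⇒ `Im VF(2π/3) < 0`**, reference position: west block, hole and `K_N1 = (1,4)` absent, no western
door of the far cell's column above row `4` ⇒ the over route is `w₁`-killed and the block's under witness is `w₁`-free.
[cite: GlazmanManolescu2019, Lemma 2.1 (statement, "in the form given in [Gl]")] [cite: GlazmanManolescu2019, §1, remark after eq. (1)] -/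
theorem im_neg_two_pi_div_three_of_killNW_block42 (hB : ∀ c ∈ westBlock42, c ∈ Dl) (hh : holeFaceW w42 ∉ dom Dl)
    (hKN : killNW w42 ∉ dom Dl)
    (hcolN : ∀ y : ℤ, w42.2 + 3 ≤ y → (w42.1 - 3, y) ∉ dom Dl ∨ (w42.1 - 2, y) ∉ dom Dl) :
    (vertexFunctional (printedWeights (2 * π / 3)) tFiveEighths (ybCoeff (2 * π / 3)) Dl (w42.side .W) (farW w42)).im < 0 := by
  have hf : farW w42 ∈ Dl := hB _ (by decide)
  have hr := rootedFace_of_farW_mem_of_hole hf hh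
  exact im_vertexFunctional_printed_farCellW_two_pi_div_three_neg_of_over_killed Dl w42 hf hh hr
    (ΩG.over_killed_of_killNW_quadrant hh hKN (fun y hy => (hcolN y hy).elim Or.inl fun h => Or.inr (Or.inl h)) hr _)
    (exists_under_witness_of_westBlock42 hB hr _)

/-- ★★★★ **`K_N2` ALONE ⇒ `Im VF(π/3) < 0`**, reference position: east block, hole and `K_N2 = (5,4)` absent, no western door
of column `5` above row `4` ⇒ the over route is `w₂`-killed (EAST QUADRANT) and the block's under witness is `w₂`-free.
[cite: GlazmanManolescu2019, Lemma 2.1 (statement, "in the form given in [Gl]")] [cite: GlazmanManolescu2019, §1 (the paragraph of Fig. 2)] -/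
theorem im_neg_pi_div_three_of_killNE_block42 (hB : ∀ c ∈ eastBlock42, c ∈ Dl) (hh : holeFaceW w42 ∉ dom Dl)
    (hKN : killNE w42 ∉ dom Dl)
    (hcolN : ∀ y : ℤ, w42.2 + 3 ≤ y → (w42.1, y) ∉ dom Dl ∨ (w42.1 + 1, y) ∉ dom Dl) :
    (vertexFunctional (printedWeights (π / 3)) tFiveEighths (ybCoeff (π / 3)) Dl (w42.side .W) (farW w42)).im < 0 := by
  have hf : farW w42 ∈ Dl := hB _ (by decide)
  have hr := rootedFace_of_farW_mem_of_hole hf hh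
  exact im_vertexFunctional_printed_farCellW_pi_div_three_neg_of_over_killed Dl w42 hf hh hr
    (ΩG.over_w2_killed_of_killNE_quadrant hh hKN hcolN hr _) (exists_under_witness_of_eastBlock42 hB hr _)

/-- ★★★★ **`K_S1` ALONE ⇒ `Im VF(2π/3) > 0`**, reference position: east block, hole and `K_S1 = (5,0)` absent, no western door
of column `5` below row `0` ⇒ the under route is `w₁`-killed and the block's over witness is `w₁`-free.
[cite: GlazmanManolescu2019, Lemma 2.1 (statement, "in the form given in [Gl]")] [cite: GlazmanManolescu2019, §1, remark after eq. (1)] -/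
theorem im_pos_two_pi_div_three_of_killSE_block42 (hB : ∀ c ∈ eastBlock42, c ∈ Dl) (hh : holeFaceW w42 ∉ dom Dl)
    (hKS : killSE w42 ∉ dom Dl)
    (hcolS : ∀ y : ℤ, y ≤ w42.2 - 3 → (w42.1, y) ∉ dom Dl ∨ (w42.1 + 1, y) ∉ dom Dl) :
    0 < (vertexFunctional (printedWeights (2 * π / 3)) tFiveEighths (ybCoeff (2 * π / 3)) Dl (w42.side .W)
      (farW w42)).im := by
  have hf : farW w42 ∈ Dl := hB _ (by decide)
  have hr := rootedFace_of_farW_mem_of_hole hf hh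
  exact im_vertexFunctional_printed_farCellW_two_pi_div_three_pos_of_under_killed Dl w42 hf hh hr
    (ΩG.under_w1_killed_of_killSE_quadrant hh hKS hcolS hr _) (exists_over_witness_of_eastBlock42 hB hr _)

end At42

/-! ## §2 Every position -/

section Translate

variable (Dl : List Face) (w : Face)

/-- The vertex functional at `(Dl, w)` is the one at the reference position of the back-translated list.
[cite: GlazmanManolescu2019, §4.2 (translation invariance)] -/
theorem vertexFunctional_printed_eq_refShift (θ : ℝ) :
    vertexFunctional (printedWeights θ) tFiveEighths (ybCoeff θ) Dl (w.side .W) (farW w) =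
      vertexFunctional (printedWeights θ) tFiveEighths (ybCoeff θ) (Dl.map (Face.shiftBy (-refShift w))) (w42.side .W)
        (farW w42) := by
  have key := vertexFunctional_printed_shiftBy (refShift w) θ (Dl.map (Face.shiftBy (-refShift w))) (w42.side .W) (farW w42)
  rw [map_shiftBy_map_shiftBy_neg, shiftBy_refShift_root, shiftBy_refShift_farW] at key
  exact key

variable {Dl w}

/-- Transport of the block hypothesis to the reference position. [cite: GlazmanManolescu2019, §4.2 (translation invariance)] -/
theorem westBlock42_mem_of_westBlock (hB : ∀ c ∈ westBlock w, c ∈ Dl) :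
    ∀ c ∈ westBlock42, c ∈ Dl.map (Face.shiftBy (-refShift w)) := fun c hc =>
  (mem_dom_map_shiftBy_neg (refShift w) Dl c).2 (hB _ (List.mem_map.2 ⟨c, hc, rfl⟩))

/-- Transport of the block hypothesis to the reference position (east). [cite: GlazmanManolescu2019, §4.2 (translation invariance)] -/
theorem eastBlock42_mem_of_eastBlock (hB : ∀ c ∈ eastBlock w, c ∈ Dl) :
    ∀ c ∈ eastBlock42, c ∈ Dl.map (Face.shiftBy (-refShift w)) := fun c hc =>
  (mem_dom_map_shiftBy_neg (refShift w) Dl c).2 (hB _ (List.mem_map.2 ⟨c, hc, rfl⟩))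

/-- Transport of an absent cell to the reference position. [cite: GlazmanManolescu2019, §4.2 (translation invariance)] -/
theorem not_mem_refShift (x y : ℤ) (h : ((x + (w.1 - 4), y + (w.2 - 2)) : Face) ∉ dom Dl) :
    ((x, y) : Face) ∉ dom (Dl.map (Face.shiftBy (-refShift w))) := by
  rw [mem_dom_map_shiftBy_neg, shiftBy_refShift_mk]; exact h

/-- ★★★★★ **`K_S2` ALONE ⇒ `Im VF(π/3) > 0`, EVERY POSITION**: for every finite face list containing the west witness block
`westBlock w`, with the hole `(w.1 − 1, w.2)` and `K_S2 = (w.1 − 3, w.2 − 2)` absent and no western door of the far cell's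
column below the kill row, `Im VF(π/3; Dl, w.side W, farW w) > 0`. [cite: GlazmanManolescu2019, Lemma 2.1, §4.2]
[cite: GlazmanManolescu2019, §1 (the paragraph of Fig. 2)] [cite: CourantRobbins1958, Ch. V Appendix §2 (the even–odd rule)] -/
theorem im_vertexFunctional_printed_pi_div_three_pos_of_killSW_block (hB : ∀ c ∈ westBlock w, c ∈ Dl)
    (hh : holeFaceW w ∉ dom Dl) (hKS : killSW w ∉ dom Dl)
    (hcolS : ∀ y : ℤ, y ≤ w.2 - 3 → (w.1 - 3, y) ∉ dom Dl ∨ (w.1 - 2, y) ∉ dom Dl) :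
    0 < (vertexFunctional (printedWeights (π / 3)) tFiveEighths (ybCoeff (π / 3)) Dl (w.side .W) (farW w)).im := by
  rw [vertexFunctional_printed_eq_refShift Dl w]
  refine im_pos_pi_div_three_of_killSW_block42 (westBlock42_mem_of_westBlock hB) ?_ ?_ ?_
  · rw [mem_dom_map_shiftBy_neg, shiftBy_refShift_holeFaceW]; exact hh
  · refine not_mem_refShift 1 0 ?_
    have e : ((1 + (w.1 - 4), 0 + (w.2 - 2)) : Face) = killSW w := Prod.ext (by simp [killSW]; ring) (by simp [killSW])
    rw [e]; exact hKS
  · intro y hy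
    simp only [w42] at hy ⊢
    rw [show ((4 : ℤ) - 3, y) = ((1 : ℤ), y) by norm_num, show ((4 : ℤ) - 2, y) = ((2 : ℤ), y) by norm_num]
    rcases hcolS (y + (w.2 - 2)) (by omega) with h | h
    · left; refine not_mem_refShift 1 y ?_
      have e : ((1 + (w.1 - 4), y + (w.2 - 2)) : Face) = (w.1 - 3, y + (w.2 - 2)) := Prod.ext (by show 1 + (w.1 - 4) = w.1 - 3; ring) rfl
      rw [e]; exact h
    · right; refine not_mem_refShift 2 y ?_
      have e : ((2 + (w.1 - 4), y + (w.2 - 2)) : Face) = (w.1 - 2, y + (w.2 - 2)) := Prod.ext (by show 2 + (w.1 - 4) = w.1 - 2; ring) rfl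
      rw [e]; exact h

/-- ★★★★★ **`K_N1` ALONE ⇒ `Im VF(2π/3) < 0`, EVERY POSITION.** [cite: GlazmanManolescu2019, Lemma 2.1, §4.2]
[cite: GlazmanManolescu2019, §1, remark after eq. (1)] [cite: CourantRobbins1958, Ch. V Appendix §2 (the even–odd rule)] -/
theorem im_vertexFunctional_printed_two_pi_div_three_neg_of_killNW_block (hB : ∀ c ∈ westBlock w, c ∈ Dl)
    (hh : holeFaceW w ∉ dom Dl) (hKN : killNW w ∉ dom Dl)
    (hcolN : ∀ y : ℤ, w.2 + 3 ≤ y → (w.1 - 3, y) ∉ dom Dl ∨ (w.1 - 2, y) ∉ dom Dl) :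
    (vertexFunctional (printedWeights (2 * π / 3)) tFiveEighths (ybCoeff (2 * π / 3)) Dl (w.side .W) (farW w)).im < 0 := by
  rw [vertexFunctional_printed_eq_refShift Dl w]
  refine im_neg_two_pi_div_three_of_killNW_block42 (westBlock42_mem_of_westBlock hB) ?_ ?_ ?_
  · rw [mem_dom_map_shiftBy_neg, shiftBy_refShift_holeFaceW]; exact hh
  · refine not_mem_refShift 1 4 ?_
    have e : ((1 + (w.1 - 4), 4 + (w.2 - 2)) : Face) = killNW w := Prod.ext (by simp [killNW]; ring) (by simp [killNW]; ring)
    rw [e]; exact hKN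
  · intro y hy
    simp only [w42] at hy ⊢
    rw [show ((4 : ℤ) - 3, y) = ((1 : ℤ), y) by norm_num, show ((4 : ℤ) - 2, y) = ((2 : ℤ), y) by norm_num]
    rcases hcolN (y + (w.2 - 2)) (by omega) with h | h
    · left; refine not_mem_refShift 1 y ?_
      have e : ((1 + (w.1 - 4), y + (w.2 - 2)) : Face) = (w.1 - 3, y + (w.2 - 2)) := Prod.ext (by show 1 + (w.1 - 4) = w.1 - 3; ring) rfl
      rw [e]; exact h
    · right; refine not_mem_refShift 2 y ?_
      have e : ((2 + (w.1 - 4), y + (w.2 - 2)) : Face) = (w.1 - 2, y + (w.2 - 2)) := Prod.ext (by show 2 + (w.1 - 4) = w.1 - 2; ring) rfl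
      rw [e]; exact h

/-- ★★★★★ **`K_N2` ALONE ⇒ `Im VF(π/3) < 0`, EVERY POSITION** (nothing east of column `w.1 + 1`). [cite: GlazmanManolescu2019, Lemma 2.1, §4.2]
[cite: GlazmanManolescu2019, §1 (the paragraph of Fig. 2)] [cite: CourantRobbins1958, Ch. V Appendix §2 (the even–odd rule)] -/
theorem im_vertexFunctional_printed_pi_div_three_neg_of_killNE_block (hB : ∀ c ∈ eastBlock w, c ∈ Dl)
    (hh : holeFaceW w ∉ dom Dl) (hKN : killNE w ∉ dom Dl)
    (hcolN : ∀ y : ℤ, w.2 + 3 ≤ y → (w.1, y) ∉ dom Dl ∨ (w.1 + 1, y) ∉ dom Dl) :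
    (vertexFunctional (printedWeights (π / 3)) tFiveEighths (ybCoeff (π / 3)) Dl (w.side .W) (farW w)).im < 0 := by
  rw [vertexFunctional_printed_eq_refShift Dl w]
  refine im_neg_pi_div_three_of_killNE_block42 (eastBlock42_mem_of_eastBlock hB) ?_ ?_ ?_
  · rw [mem_dom_map_shiftBy_neg, shiftBy_refShift_holeFaceW]; exact hh
  · refine not_mem_refShift 5 4 ?_
    have e : ((5 + (w.1 - 4), 4 + (w.2 - 2)) : Face) = killNE w := Prod.ext (by simp [killNE]; ring) (by simp [killNE]; ring)
    rw [e]; exact hKN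
  · intro y hy
    simp only [w42] at hy ⊢
    rw [show ((4 : ℤ) + 1, y) = ((5 : ℤ), y) by norm_num]
    rcases hcolN (y + (w.2 - 2)) (by omega) with h | h
    · left; refine not_mem_refShift 4 y ?_
      have e : ((4 + (w.1 - 4), y + (w.2 - 2)) : Face) = (w.1, y + (w.2 - 2)) := Prod.ext (by show 4 + (w.1 - 4) = w.1; ring) rfl
      rw [e]; exact h
    · right; refine not_mem_refShift 5 y ?_
      have e : ((5 + (w.1 - 4), y + (w.2 - 2)) : Face) = (w.1 + 1, y + (w.2 - 2)) := Prod.ext (by show 5 + (w.1 - 4) = w.1 + 1; ring) rfl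
      rw [e]; exact h

/-- ★★★★★ **`K_S1` ALONE ⇒ `Im VF(2π/3) > 0`, EVERY POSITION** (nothing east of column `w.1 + 1`). [cite: GlazmanManolescu2019, Lemma 2.1, §4.2]
[cite: GlazmanManolescu2019, §1, remark after eq. (1)] [cite: CourantRobbins1958, Ch. V Appendix §2 (the even–odd rule)] -/
theorem im_vertexFunctional_printed_two_pi_div_three_pos_of_killSE_block (hB : ∀ c ∈ eastBlock w, c ∈ Dl)
    (hh : holeFaceW w ∉ dom Dl) (hKS : killSE w ∉ dom Dl)
    (hcolS : ∀ y : ℤ, y ≤ w.2 - 3 → (w.1, y) ∉ dom Dl ∨ (w.1 + 1, y) ∉ dom Dl) :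
    0 < (vertexFunctional (printedWeights (2 * π / 3)) tFiveEighths (ybCoeff (2 * π / 3)) Dl (w.side .W) (farW w)).im := by
  rw [vertexFunctional_printed_eq_refShift Dl w]
  refine im_pos_two_pi_div_three_of_killSE_block42 (eastBlock42_mem_of_eastBlock hB) ?_ ?_ ?_
  · rw [mem_dom_map_shiftBy_neg, shiftBy_refShift_holeFaceW]; exact hh
  · refine not_mem_refShift 5 0 ?_
    have e : ((5 + (w.1 - 4), 0 + (w.2 - 2)) : Face) = killSE w := Prod.ext (by simp [killSE]; ring) (by simp [killSE])
    rw [e]; exact hKS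
  · intro y hy
    simp only [w42] at hy ⊢
    rw [show ((4 : ℤ) + 1, y) = ((5 : ℤ), y) by norm_num]
    rcases hcolS (y + (w.2 - 2)) (by omega) with h | h
    · left; refine not_mem_refShift 4 y ?_
      have e : ((4 + (w.1 - 4), y + (w.2 - 2)) : Face) = (w.1, y + (w.2 - 2)) := Prod.ext (by show 4 + (w.1 - 4) = w.1; ring) rfl
      rw [e]; exact h
    · right; refine not_mem_refShift 5 y ?_
      have e : ((5 + (w.1 - 4), y + (w.2 - 2)) : Face) = (w.1 + 1, y + (w.2 - 2)) := Prod.ext (by show 5 + (w.1 - 4) = w.1 + 1; ring) rfl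
      rw [e]; exact h

end Translate

end Literature.Barriers.CriticalPhenomena.PlaquetteWalk
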